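import Summits.QuantumAdvantage.QuantumAdvantage.Theorems.LinnikCubicClassGroupsDegreeOnePrimesEscapeDivisionPNTPiCongr
import Summits.QuantumAdvantage.QuantumAdvantage.Theorems.LinnikCubicClassGroupsDegreeOnePrimesEscapeChebotarevDivisionSplittingType
import Literature.NumberTheory.LFunctions.StarkNoQuadraticSubfieldGlue
import Mathlib.FieldTheory.Normal.Basic
import HarnessLib

/-!
# The prime number theorem for the completely split primes of an arbitrary number field, Linnik range

Topic `Summits/QuantumAdvantage/QuantumAdvantage/Theorems`, cell B2b-1 (linnik-cubic), PART A (gen 11);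
helper toward the crux `DegreeOnePrimesEscape` (stmt-QuantumAdvantage-11543) of route
`LinnikCubicClassGroups`.  HONEST FRAMING: the value of this file is a THEOREM (kernel-checked, GRH-free,
Siegel-free, no hypothesis) — NOT summit progress.

**Theorem** (`splitPrimes_PNT`).  Let `n > 1`, `0 < ε ≤ 1`.  There are `L > 0`, `0 < c ≤ 1/4` such that for
EVERY number field `K` of degree `n` there are `m ∈ [n, n!]` (the degree of the Galois closure of `K`),
`θ ∈ {0,1}` and `β₁ ∈ (1 − c/(log|d_K| + log 4), 1)` with, for all `x ≥ |d_K|^L`,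

  `|#{p ≤ x : p splits completely in K} − (Li(x) − θ Li(x^{β₁}))/m| ≤ ε (Li(x) − θ Li(x^{β₁}))/m`

(`p` splits completely `⟺ splittingType K p = {1, …, 1}`; all primes counted; `Li = offsetLogIntegral`).
The density of the completely split primes is `1/[Ñ:ℚ]`; a possible exceptional (Siegel) zero `β₁` of `ζ_Ñ`
can only DEPRESS their count (the Frobenius class `{1}` lies in every index-two subgroup), hence also
`#{p ≤ x : p splits completely in K} ≤ (1 + ε) Li(x)/m`.  This is the counting form, in the Linnik range, of
the least completely split prime (`…LeastSplitPrime.lean`, `…NonsplitPrimeAnyField.lean`), for all number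
fields at once. [cite: LagariasMontgomeryOdlyzko1979, Theorem 1.1] [cite: ThornerZaman2019, Theorem 1.4]

Ingredients: `exists_galoisClosure` (Galois closure `N` with separating embeddings and `|d_N| ≤ |d_K|^{[N:ℚ]}`),
the dictionary `splitsCompletely_iff_frobenius_eq_one` (Dedekind: `p ∤ d_N` splits completely in `K` iff
`Frob_p = 1` in `Gal(N/ℚ)`, via the permutation character `card_fixingSubgroup_mul_sum_filter_dvd` and the
separation of `Gal(N/ℚ)` by the conjugates of `K`), and `division_PNT_pi_congr` for `σ = 1`.
-/

noncomputable section

open scoped NumberField nonZeroDivisors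
open Finset Real Ideal NumberField
open Literature.NumberTheory.NumberFields Literature.NumberTheory.LFunctions
  Literature.NumberTheory.LFunctions.NumberField

namespace Summit.QuantumAdvantage.QuantumAdvantage.Theorems.DegreeOnePrimesEscape

/-! ### The division of `1` -/

/-- `Div 1 = {1}`: `|{τ : ⟨gτg⁻¹⟩ = ⟨1⟩}| = 1`. -/
theorem natCard_division_one {G : Type*} [Group G] :
    Nat.card {τ : G // ∃ g : G, Subgroup.zpowers (g * τ * g⁻¹) = Subgroup.zpowers (1 : G)} = 1 := by
  rw [Nat.card_eq_one_iff_unique]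
  refine ⟨⟨?_⟩, ⟨⟨1, 1, by simp⟩⟩⟩
  rintro ⟨a, g, hg⟩ ⟨b, g', hg'⟩
  rw [Subgroup.zpowers_one_eq_bot, Subgroup.zpowers_eq_bot, conj_eq_one_iff] at hg hg'
  subst hg hg'
  rfl

/-! ### Completely split primes and the trivial Frobenius -/

section Split

variable {N : Type} [Field N] [NumberField N] [IsGalois ℚ N]

/-- The sums `Σ_{f ∈ {1,…,1}, f ∣ j} f = n`. -/
theorem sum_filter_dvd_replicate_one (n j : ℕ) :
    ((Multiset.replicate n 1).filter (· ∣ j)).sum = n := by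
  rw [Multiset.filter_eq_self.mpr (fun a ha => by rw [Multiset.eq_of_mem_replicate ha]; exact one_dvd j),
    Multiset.sum_replicate, smul_eq_mul, mul_one]

/-- **At the trivial Frobenius every subfield splits completely**: if `φ = 1` is a Frobenius at `Q ∣ p`
with trivial inertia, then `splittingType E p = {1, …, 1}` for every `E ⊆ N`. [cite: Perlis1977, §1] -/
theorem splittingType_eq_replicate_one_of_frobenius_one (E : IntermediateField ℚ N) {p : ℕ} (hp : p.Prime)
    (Q : Ideal (𝓞 N)) [Q.IsMaximal] [Q.LiesOver (span {(p : ℤ)})] (hφ : IsArithFrobAt ℤ (1 : N ≃ₐ[ℚ] N) Q)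
    (hI : Q.inertia (N ≃ₐ[ℚ] N) = ⊥) :
    splittingType E p = Multiset.replicate (Module.finrank ℚ E) 1 := by
  classical
  have hH : Nat.card E.fixingSubgroup = Module.finrank E N := IsGalois.card_fixingSubgroup_eq_finrank E
  have hHpos : 0 < Nat.card E.fixingSubgroup := Nat.card_pos
  have hmul := Module.finrank_mul_finrank ℚ E N
  have hsums : ∀ j : ℕ, ((splittingType E p).filter (· ∣ j)).sum =
      ((Multiset.replicate (Module.finrank ℚ E) 1).filter (· ∣ j)).sum := by
    intro j
    have hk := card_fixingSubgroup_mul_sum_filter_dvd E hp Q hφ hI j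
    have hall : Nat.card {g : N ≃ₐ[ℚ] N // g * (1 : N ≃ₐ[ℚ] N) ^ j * g⁻¹ ∈ E.fixingSubgroup} =
        Nat.card (N ≃ₐ[ℚ] N) :=
      Nat.card_congr (Equiv.subtypeUnivEquiv fun g => by
        rw [one_pow, mul_one, mul_inv_cancel]; exact one_mem _)
    rw [hall, IsGalois.card_aut_eq_finrank, ← hmul, hH, mul_comm] at hk
    rw [sum_filter_dvd_replicate_one]
    exact Nat.eq_of_mul_eq_mul_right (hH ▸ hHpos) hk
  exact eq_of_forall_sum_filter_dvd_eq _ _ _ rfl (fun f hf => splittingType_pos hp hf)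
    (fun f hf => by rw [Multiset.eq_of_mem_replicate hf]; exact one_pos) hsums

/-- **A Frobenius that splits `K'` completely is conjugate into `Gal(N/K')` by everything**: if
`splittingType K' p = {1,…,1}` and `φ` is a Frobenius at `Q ∣ p` with trivial inertia, then
`s φ s⁻¹ ∈ Gal(N/K')` for every `s`. -/
theorem forall_conj_mem_of_splittingType_eq_replicate_one (K' : IntermediateField ℚ N) {p : ℕ} (hp : p.Prime)
    (Q : Ideal (𝓞 N)) [Q.IsMaximal] [Q.LiesOver (span {(p : ℤ)})] {φ : N ≃ₐ[ℚ] N} (hφ : IsArithFrobAt ℤ φ Q)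
    (hI : Q.inertia (N ≃ₐ[ℚ] N) = ⊥)
    (hT : splittingType K' p = Multiset.replicate (Module.finrank ℚ K') 1) :
    ∀ s : N ≃ₐ[ℚ] N, s * φ * s⁻¹ ∈ K'.fixingSubgroup := by
  classical
  have hH : Nat.card K'.fixingSubgroup = Module.finrank K' N := IsGalois.card_fixingSubgroup_eq_finrank K'
  have hmul := Module.finrank_mul_finrank ℚ K' N
  have hk := card_fixingSubgroup_mul_sum_filter_dvd K' hp Q hφ hI 1
  rw [hT, sum_filter_dvd_replicate_one, pow_one, hH, mul_comm, hmul, ← IsGalois.card_aut_eq_finrank] at hk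
  -- the subtype `{s : s φ s⁻¹ ∈ H}` has full cardinality, hence is everything
  by_contra hnot
  push Not at hnot
  obtain ⟨s, hs⟩ := hnot
  have hlt := Finite.card_subtype_lt (p := fun s : N ≃ₐ[ℚ] N => s * φ * s⁻¹ ∈ K'.fixingSubgroup) hs
  omega

/-- **Completely split ⟺ trivial Frobenius**, for a separating family of embeddings.  Let `N/ℚ` be
Galois, `f : K →ₐ N` with `Gal(N/ℚ)` separated by the embeddings of `K` (`exists_galoisClosure`).  For a prime
`p ∤ d_N`: `splittingType K p = {1,…,1}` iff some (every) Frobenius at `p` with trivial inertia generates the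
same cyclic group as `1`, i.e. is trivial. [cite: Perlis1977, §1] -/
theorem splitsCompletely_iff_frobenius_division_one {K : Type} [Field K] [NumberField K] (f : K →ₐ[ℚ] N)
    (hsep : ∀ s : N ≃ₐ[ℚ] N, s ≠ 1 → ∃ f' : K →ₐ[ℚ] N, s ∉ f'.fieldRange.fixingSubgroup)
    {p : ℕ} (hp : p.Prime) (hpN : ¬ ((p : ℤ) ∣ NumberField.discr N)) :
    splittingType K p = Multiset.replicate (Module.finrank ℚ K) 1 ↔
      ∃ (Q : Ideal (𝓞 N)) (_ : Q.IsMaximal) (_ : Q.LiesOver (span {(p : ℤ)})) (φ g : N ≃ₐ[ℚ] N),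
        IsArithFrobAt ℤ φ Q ∧ Q.inertia (N ≃ₐ[ℚ] N) = ⊥ ∧
          Subgroup.zpowers (g * φ * g⁻¹) = Subgroup.zpowers (1 : N ≃ₐ[ℚ] N) := by
  classical
  set K' : IntermediateField ℚ N := f.fieldRange with hK'def
  set e : K ≃ₐ[ℚ] K' := f.equivFieldRange with hedef
  have hfin : Module.finrank ℚ K' = Module.finrank ℚ K := (e.toLinearEquiv.finrank_eq).symm
  constructor
  · intro hT
    obtain ⟨Q, hQmax, hQover, ⟨φ, hφ⟩, hI⟩ := exists_isArithFrobAt_of_not_dvd_discr (N := N) hp hpN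
    have hT' : splittingType K' p = Multiset.replicate (Module.finrank ℚ K') 1 := by
      rw [← ArithmeticallyEquivalent.of_algEquiv e p hp, hfin]; exact hT
    have hconj := forall_conj_mem_of_splittingType_eq_replicate_one K' hp Q hφ hI hT'
    -- `φ` fixes every conjugate of `K'`, hence `φ = 1` by separation
    have hφ1 : φ = 1 := by
      by_contra hne
      obtain ⟨f', hf'⟩ := hsep φ hne
      apply hf'
      rw [IntermediateField.mem_fixingSubgroup_iff]
      intro y hy
      obtain ⟨a, rfl⟩ := (AlgHom.mem_fieldRange).mp hy
      -- an automorphism `t` of `N` with `t (f z) = f' z`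
      set χ : K' ≃ₐ[ℚ] f'.fieldRange := e.symm.trans f'.equivFieldRange with hχ
      set t : N ≃ₐ[ℚ] N := χ.liftNormal N with ht
      have htz : t ((e a : K') : N) = f' a := by
        have h1 : t (algebraMap K' N (e a)) = algebraMap f'.fieldRange N (χ (e a)) := χ.liftNormal_commutes N (e a)
        have h2 : ((χ (e a) : f'.fieldRange) : N) = f' a := by
          rw [hχ, AlgEquiv.trans_apply, AlgEquiv.symm_apply_apply]
          rfl
        exact h1.trans h2
      have hmem := hconj t⁻¹
      rw [inv_inv, IntermediateField.mem_fixingSubgroup_iff] at hmem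
      have h3 := hmem ((e a : K') : N) (e a).2
      -- `(t⁻¹ φ t) z = z` gives `φ (t z) = t z`
      rw [AlgEquiv.mul_apply, AlgEquiv.mul_apply, AlgEquiv.aut_inv, AlgEquiv.symm_apply_eq] at h3
      rw [← htz]
      exact h3
    subst hφ1
    exact ⟨Q, hQmax, hQover, 1, 1, hφ, hI, by simp⟩
  · rintro ⟨Q, hQmax, hQover, φ, g, hφ, hI, hg⟩
    rw [Subgroup.zpowers_one_eq_bot, Subgroup.zpowers_eq_bot, conj_eq_one_iff] at hg
    subst hg
    rw [ArithmeticallyEquivalent.of_algEquiv e p hp, ← hfin]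
    exact splittingType_eq_replicate_one_of_frobenius_one K' hp Q hφ hI

end Split

/-! ### The theorem -/

set_option maxHeartbeats 4000000 in
/-- **The prime number theorem for the completely split primes of an arbitrary number field in the Linnik
range** (see the module docstring): density `1/m`, `m = [Ñ:ℚ] ∈ [n, n!]`, secondary term `−θ Li(x^{β₁})/m`
with `θ ∈ {0,1}`, relative error `ε`, all `x ≥ |d_K|^L`; every number field of degree `n`.  Unconditional.
[cite: LagariasMontgomeryOdlyzko1979, Theorem 1.1] [cite: ThornerZaman2019, Theorem 1.4] -/
theorem splitPrimes_PNT (n : ℕ) (hn : 1 < n) {ε : ℝ} (hε : 0 < ε) (hε1 : ε ≤ 1) :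
    ∃ L c : ℝ, 0 < L ∧ 0 < c ∧ c ≤ 1 / 4 ∧ ∀ (K : Type) [Field K] [NumberField K], Module.finrank ℚ K = n →
      ∃ m : ℕ, n ≤ m ∧ m ≤ n.factorial ∧ ∃ θ β₁ : ℝ, (θ = 0 ∨ θ = 1) ∧
        1 - c / (Real.log ((NumberField.discr K).natAbs : ℝ) + Real.log 4) < β₁ ∧ β₁ < 1 ∧
        ∀ x : ℝ, ((NumberField.discr K).natAbs : ℝ) ^ L ≤ x →
          |((((Nat.primesLE ⌊x⌋₊).filter
              (fun p : ℕ => splittingType K p = Multiset.replicate n 1)).card : ℕ) : ℝ) -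
              (offsetLogIntegral x - θ * offsetLogIntegral (x ^ β₁)) / m| ≤
            ε * ((offsetLogIntegral x - θ * offsetLogIntegral (x ^ β₁)) / m) := by
  classical
  -- one exponent and one window constant for every possible degree `m ≤ n!` of the closure
  have hdeg : ∀ m : ℕ, ∃ L c : ℝ, 0 < L ∧ 0 < c ∧ c ≤ 1 / 4 ∧ (1 < m →
      ∀ (N : Type) [Field N] [NumberField N] [IsGalois ℚ N], Module.finrank ℚ N = m →
        ∀ σ : N ≃ₐ[ℚ] N, ∀ (P : ℕ → Prop) [DecidablePred P],
        (∀ p : ℕ, p.Prime → ¬ ((p : ℤ) ∣ NumberField.discr N) →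
          (P p ↔ ∃ (Q : Ideal (𝓞 N)) (_ : Q.IsMaximal) (_ : Q.LiesOver (span {(p : ℤ)})) (φ g : N ≃ₐ[ℚ] N),
            IsArithFrobAt ℤ φ Q ∧ Q.inertia (N ≃ₐ[ℚ] N) = ⊥ ∧
              Subgroup.zpowers (g * φ * g⁻¹) = Subgroup.zpowers σ)) →
        ((¬ ∃ β₁ : ℝ, dedekindZeta₁ N β₁ = 0 ∧
            1 - c / (Real.log ((NumberField.discr N).natAbs : ℝ) + Real.log 4) < β₁ ∧ β₁ < 1) →
          ∀ x : ℝ, ((NumberField.discr N).natAbs : ℝ) ^ L ≤ x →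
            |((((Nat.primesLE ⌊x⌋₊).filter P).card : ℕ) : ℝ) -
              (Nat.card {τ : N ≃ₐ[ℚ] N // ∃ g : N ≃ₐ[ℚ] N,
                  Subgroup.zpowers (g * τ * g⁻¹) = Subgroup.zpowers σ} : ℝ) / Nat.card (N ≃ₐ[ℚ] N) *
                offsetLogIntegral x| ≤
              ε * ((Nat.card {τ : N ≃ₐ[ℚ] N // ∃ g : N ≃ₐ[ℚ] N,
                  Subgroup.zpowers (g * τ * g⁻¹) = Subgroup.zpowers σ} : ℝ) / Nat.card (N ≃ₐ[ℚ] N) *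
                offsetLogIntegral x)) ∧
        (∀ β₁ : ℝ, dedekindZeta₁ N β₁ = 0 →
          1 - c / (Real.log ((NumberField.discr N).natAbs : ℝ) + Real.log 4) < β₁ → β₁ < 1 →
          (dedekindZeta₁ (IntermediateField.fixedField (Subgroup.zpowers σ)) β₁ = 0 →
            ∀ x : ℝ, ((NumberField.discr N).natAbs : ℝ) ^ L ≤ x →
              |((((Nat.primesLE ⌊x⌋₊).filter P).card : ℕ) : ℝ) -
                (Nat.card {τ : N ≃ₐ[ℚ] N // ∃ g : N ≃ₐ[ℚ] N,
                    Subgroup.zpowers (g * τ * g⁻¹) = Subgroup.zpowers σ} : ℝ) / Nat.card (N ≃ₐ[ℚ] N) *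
                  (offsetLogIntegral x - offsetLogIntegral (x ^ β₁))| ≤
                ε * ((Nat.card {τ : N ≃ₐ[ℚ] N // ∃ g : N ≃ₐ[ℚ] N,
                    Subgroup.zpowers (g * τ * g⁻¹) = Subgroup.zpowers σ} : ℝ) / Nat.card (N ≃ₐ[ℚ] N) *
                  (offsetLogIntegral x - offsetLogIntegral (x ^ β₁)))) ∧
          (dedekindZeta₁ (IntermediateField.fixedField (Subgroup.zpowers σ)) β₁ ≠ 0 →
            ∀ x : ℝ, ((NumberField.discr N).natAbs : ℝ) ^ L ≤ x →
              |((((Nat.primesLE ⌊x⌋₊).filter P).card : ℕ) : ℝ) -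
                (Nat.card {τ : N ≃ₐ[ℚ] N // ∃ g : N ≃ₐ[ℚ] N,
                    Subgroup.zpowers (g * τ * g⁻¹) = Subgroup.zpowers σ} : ℝ) / Nat.card (N ≃ₐ[ℚ] N) *
                  (offsetLogIntegral x + offsetLogIntegral (x ^ β₁))| ≤
                ε * ((Nat.card {τ : N ≃ₐ[ℚ] N // ∃ g : N ≃ₐ[ℚ] N,
                    Subgroup.zpowers (g * τ * g⁻¹) = Subgroup.zpowers σ} : ℝ) / Nat.card (N ≃ₐ[ℚ] N) *
                  (offsetLogIntegral x + offsetLogIntegral (x ^ β₁)))))) := by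
    intro m
    by_cases hm : 1 < m
    · obtain ⟨L, c, hL, hc, -, hc4, h⟩ := division_PNT_pi_congr m hm hε hε1 one_pos
      exact ⟨L, c, hL, hc, hc4, fun _ => h⟩
    · exact ⟨1, 1 / 4, one_pos, by norm_num, le_rfl, fun h => absurd h hm⟩
  choose Lf cf hLf hcf hcf4 hPNT using hdeg
  set S : Finset ℕ := Finset.range (n.factorial + 1) with hS
  have hSne : S.Nonempty := ⟨0, by simp [hS]⟩
  set L : ℝ := (n.factorial : ℝ) * ∑ m ∈ S, Lf m with hL
  set c : ℝ := S.sup' hSne cf with hc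
  have hmemS : ∀ m ≤ n.factorial, m ∈ S := fun m hm => Finset.mem_range.mpr (Nat.lt_succ_of_le hm)
  have hsum1 : ∀ m ≤ n.factorial, Lf m ≤ ∑ m ∈ S, Lf m := fun m hm =>
    Finset.single_le_sum (f := Lf) (fun i _ => (hLf i).le) (hmemS m hm)
  have hLpos : 0 < L := by
    have : 0 < ∑ m ∈ S, Lf m := lt_of_lt_of_le (hLf 0) (hsum1 0 (Nat.zero_le _))
    rw [hL]; positivity
  have hcpos : 0 < c := lt_of_lt_of_le (hcf 0) (Finset.le_sup' cf (hmemS 0 (Nat.zero_le _)))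
  have hc4 : c ≤ 1 / 4 := Finset.sup'_le hSne cf fun m _ => hcf4 m
  refine ⟨L, c, hLpos, hcpos, hc4, fun K _ _ hK => ?_⟩
  obtain ⟨N, _, _, hGal, hNle, hKN, ⟨f⟩, hsep, hdN⟩ := exists_galoisClosure K
  haveI := hGal
  rw [hK] at hNle hKN
  set m := Module.finrank ℚ N with hmdef
  have hm1 : 1 < m := lt_of_lt_of_le hn hKN
  have hcm : cf m ≤ c := Finset.le_sup' cf (hmemS m hNle)
  -- sizes
  set d : ℝ := ((NumberField.discr K).natAbs : ℝ) with hd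
  set dN : ℝ := ((NumberField.discr N).natAbs : ℝ) with hdN'
  have hd3 : (3 : ℝ) ≤ d := three_le_natAbs_discr_real K (by rw [hK]; exact hn)
  have hd1 : (1 : ℝ) ≤ d := by linarith
  have hdN3 : (3 : ℝ) ≤ dN := three_le_natAbs_discr_real N hm1
  have hdisc' : NumberField.discr f.fieldRange = NumberField.discr K :=
    (NumberField.discr_eq_discr_of_algEquiv K f.equivFieldRange).symm
  have hdKN : d ≤ dN := by
    have hdvd : NumberField.discr K ∣ NumberField.discr N := hdisc' ▸ NumberField.discr_dvd_discr f.fieldRange N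
    rw [hd, hdN']
    exact_mod_cast Nat.le_of_dvd (Int.natAbs_pos.mpr (NumberField.discr_ne_zero N)) (Int.natAbs_dvd_natAbs.mpr hdvd)
  have hℓK : 0 < Real.log d + Real.log 4 := by
    have := Real.log_pos (by linarith : (1 : ℝ) < d); have := Real.log_pos (by norm_num : (1 : ℝ) < 4)
    linarith
  have hwin : 1 - c / (Real.log d + Real.log 4) ≤ 1 - cf m / (Real.log dN + Real.log 4) := by
    have h1 : Real.log d ≤ Real.log dN := Real.log_le_log (by linarith) hdKN
    have h2 : cf m / (Real.log dN + Real.log 4) ≤ c / (Real.log d + Real.log 4) :=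
      calc cf m / (Real.log dN + Real.log 4) ≤ c / (Real.log dN + Real.log 4) :=
            div_le_div_of_nonneg_right hcm (by linarith)
        _ ≤ c / (Real.log d + Real.log 4) := div_le_div_of_nonneg_left hcpos.le hℓK (by linarith)
    linarith
  have hxN : ∀ x : ℝ, d ^ L ≤ x → dN ^ Lf m ≤ x := by
    intro x hx
    have hdNR : dN ≤ d ^ (m : ℝ) := by rw [Real.rpow_natCast, hd, hdN']; exact_mod_cast hdN
    have h3 : (m : ℝ) * Lf m ≤ L := by
      rw [hL]
      have hmf : (m : ℝ) ≤ n.factorial := by exact_mod_cast hNle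
      exact mul_le_mul hmf (hsum1 m hNle) (hLf m).le (by positivity)
    calc dN ^ Lf m ≤ (d ^ (m : ℝ)) ^ Lf m := Real.rpow_le_rpow (by linarith) hdNR (hLf m).le
      _ = d ^ ((m : ℝ) * Lf m) := by rw [← Real.rpow_mul (by linarith)]
      _ ≤ d ^ L := Real.rpow_le_rpow_of_exponent_le hd1 h3
      _ ≤ x := hx
  -- the predicate and the density
  have hP : ∀ p : ℕ, p.Prime → ¬ ((p : ℤ) ∣ NumberField.discr N) →
      (splittingType K p = Multiset.replicate n 1 ↔
        ∃ (Q : Ideal (𝓞 N)) (_ : Q.IsMaximal) (_ : Q.LiesOver (span {(p : ℤ)})) (φ g : N ≃ₐ[ℚ] N),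
          IsArithFrobAt ℤ φ Q ∧ Q.inertia (N ≃ₐ[ℚ] N) = ⊥ ∧
            Subgroup.zpowers (g * φ * g⁻¹) = Subgroup.zpowers (1 : N ≃ₐ[ℚ] N)) := by
    intro p hp hpN
    rw [← hK]
    exact splitsCompletely_iff_frobenius_division_one f hsep hp hpN
  have hδ : (Nat.card {τ : N ≃ₐ[ℚ] N // ∃ g : N ≃ₐ[ℚ] N,
      Subgroup.zpowers (g * τ * g⁻¹) = Subgroup.zpowers (1 : N ≃ₐ[ℚ] N)} : ℝ) / Nat.card (N ≃ₐ[ℚ] N) =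
        1 / (m : ℝ) := by
    rw [natCard_division_one, IsGalois.card_aut_eq_finrank]; push_cast; rfl
  obtain ⟨hA, hB⟩ := hPNT m hm1 N rfl 1 (fun p : ℕ => splittingType K p = Multiset.replicate n 1) hP
  refine ⟨m, hKN, hNle, ?_⟩
  by_cases hexc : ∃ β₁ : ℝ, dedekindZeta₁ N β₁ = 0 ∧
      1 - cf m / (Real.log dN + Real.log 4) < β₁ ∧ β₁ < 1
  · obtain ⟨β₁, hζ₁, hβ₁c, hβ₁1⟩ := hexc
    refine ⟨1, β₁, Or.inr rfl, lt_of_le_of_lt hwin hβ₁c, hβ₁1, fun x hx => ?_⟩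
    -- `ζ_{N^{⟨1⟩}} = ζ_N` vanishes at `β₁`: case (B1)
    have hβne : (β₁ : ℂ) ≠ 1 := fun h => hβ₁1.ne (by exact_mod_cast h)
    have hfix : IntermediateField.fixedField (Subgroup.zpowers (1 : N ≃ₐ[ℚ] N)) = ⊤ := by
      rw [Subgroup.zpowers_one_eq_bot, IntermediateField.fixedField_bot]
    have eN : IntermediateField.fixedField (Subgroup.zpowers (1 : N ≃ₐ[ℚ] N)) ≃ₐ[ℚ] N :=
      (IntermediateField.equivOfEq hfix).trans IntermediateField.topEquiv
    have hζσ : dedekindZeta₁ (IntermediateField.fixedField (Subgroup.zpowers (1 : N ≃ₐ[ℚ] N))) β₁ = 0 := by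
      rw [dedekindZeta₁_eq_zero_iff hβne, dedekindZetaCont_eq_of_algEquiv eN hβne]
      exact (dedekindZeta₁_eq_zero_iff hβne).mp hζ₁
    have hmain := (hB β₁ hζ₁ hβ₁c hβ₁1).1 hζσ x (hxN x hx)
    rw [hδ] at hmain
    have e1 : 1 / (m : ℝ) * (offsetLogIntegral x - offsetLogIntegral (x ^ β₁)) =
        (offsetLogIntegral x - 1 * offsetLogIntegral (x ^ β₁)) / m := by ring
    rwa [e1] at hmain
  · refine ⟨0, 1 - c / (2 * (Real.log d + Real.log 4)), Or.inl rfl, ?_, ?_, fun x hx => ?_⟩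
    · have : c / (2 * (Real.log d + Real.log 4)) < c / (Real.log d + Real.log 4) := by
        rw [div_lt_div_iff_of_pos_left hcpos (by positivity) hℓK]; linarith
      linarith
    · have : 0 < c / (2 * (Real.log d + Real.log 4)) := by positivity
      linarith
    have hmain := hA hexc x (hxN x hx)
    rw [hδ] at hmain
    have e1 : 1 / (m : ℝ) * offsetLogIntegral x =
        (offsetLogIntegral x - 0 * offsetLogIntegral (x ^ (1 - c / (2 * (Real.log d + Real.log 4))))) / m := by
      ring
    rwa [e1] at hmain

end Summit.QuantumAdvantage.QuantumAdvantage.Theorems.DegreeOnePrimesEscape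

end
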